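import Literature.Analysis.FluidPDE.LittlewoodPaleyFields
import Literature.Analysis.FluidPDE.LerayHopfSpatialGradient
import Literature.Analysis.FluidPDE.WeakGradientDistribution
import HarnessLib

/-!
# The Cheskidov–Shvydkoy dissipation wavenumber `Λ(t)` and its time integrability (Lemma 4.1)

Analysis/FluidPDE literature file. Source: A. Cheskidov, R. Shvydkoy, *A unified approach to
regularity problems for the 3D Navier–Stokes and Euler equations: the use of Kolmogorov's
dissipation range*, J. Math. Fluid Mech. 16 (2014) 263–273 = arXiv:1102.1944 [CheskidovShvydkoy2011].

With the dyadic blocks `u_q` (`λ_q = 2^q`) and an absolute threshold `c₀`, §3 of the paper defines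
the **dissipation wavenumber**
`Λ(t) = min{λ_q : λ_p⁻¹ ‖u_p(t)‖_∞ < c₀ ν for all p > q, q ≥ 0}`
("the wavenumber that separates high frequency modes where viscosity prevails over the non-linear
term from the low frequency modes where the Euler dynamics [governs]"), i.e. `Λ(t) = 2^Q` for the top
level `Q ≥ 1` at which the *level Reynolds number* `‖u_Q(t)‖_∞/(ν λ_Q)` still reaches `c₀`, `Λ(t) = 1`
if there is none and `Λ(t) = ∞` if there are infinitely many. In this language the regularity
criterion of Cheskidov–Shvydkoy 2010 (tree: `Literature.Analysis.FluidPDE.cheskidov_shvydkoy_dyadic`,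
discharged) reads `Λ ∈ L^∞(0,T)`, Theorem 3.1 of the paper improves it to `Λ ∈ L^{5/2}(0,T)`, and
**Lemma 4.1** records the a priori information every Leray–Hopf solution carries:

> Lemma 4.1. Let `u(t)` be a Leray–Hopf solution to (NSE) with `ν > 0` on `[0,T]`. Then `Λ ∈ L¹(0,T)`.
> Proof. By Bernstein's inequality `‖u_p‖_∞ ≤ λ_p^{3/2} ‖u_p‖₂`. Therefore, since `‖∇u(t)‖₂²` is
> integrable, `c₀ ν ∫_U Λ(t) dt ≤ ∫_U Λ(t)⁻¹ ‖u_{Q(t)}‖²_∞ dt ≤ ∫_U Λ(t)² ‖u_{Q(t)}‖²₂ dt < ∞`.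

("this approach would require to fill the gap between `L¹` and `L^{5/2}` in order to solve the
regularity problem", p. 7.)

RENDERING. The blocks are the tree's homogeneous Littlewood–Paley blocks of a field
`FunctionSpaces.blockFn j v = K_j ⋆ v` at the levels `j ∈ ℕ` (for `q ≥ 0` the inhomogeneous blocks of
the paper), and level `j` of a slice `v` is *saturated* iff
`ENNReal.ofReal (c₀ ν) · 2^j ≤ ‖blockFn j v‖_{L^∞}` — verbatim the saturation predicate of the route
`Summits/NavierStokesRegularity/NavierStokesRegularity/Theses/WeakLambdaEndpoint.lean`, whose level
sets `{t | ∃ j > n saturated} = {Λ > 2^n}` are the sets bounded in `exists_two_pow_mul_volume_setOf_saturated_le`.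

* `dissipationWavenumber c₀ ν v = 1 ⊔ ⨆_{j saturated} 2^j ∈ [1, ∞]` (the definition, §3) with the
  order API `one_le_dissipationWavenumber`, `two_pow_le_dissipationWavenumber`,
  `dissipationWavenumber_le`, `dissipationWavenumber_anti` (antitone in the threshold), the level-set
  dictionary `two_pow_succ_le_dissipationWavenumber_iff` (`2^(n+1) ≤ Λ ↔ ∃ j > n saturated`),
  `two_pow_le_dissipationWavenumber_iff`, `dissipationWavenumber_eq_top_iff` (`Λ = ∞ ↔` infinitely many
  saturated levels), `dissipationWavenumber_lt_top_iff`, and the dictionary `isSaturatedLevel_iff_le_lpBlockWeight`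
  (saturation ⇔ `c₀ν ≤ lpBlockWeight (-1) ∞ V j` for the distribution `V` of the slice — the weight of
  `cheskidov_shvydkoy_dyadic` and of the FluidComputer floors);
* `exists_eLpNorm_top_blockFn_le_two_rpow_mul_dissipation` — the Bernstein step of the printed proof
  for Sobolev slices: `‖Δ̇_j v‖_∞ ≤ C 2^{j/2} (∫ |G|²)^{1/2}` for `v ∈ L²(ℝ³)` with weak gradient `G`
  (Bernstein `L² → L^∞` on the block, reverse Bernstein `‖Δ̇_j v‖₂ ≤ C 2^{-j} ∑ᵢ ‖Δ̇_j ∂ᵢ v‖₂`, and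
  `∂ᵢ` of the distribution of `v` = distribution of the weak partial derivative);
* `exists_two_pow_mul_le_dissipation_of_saturated` — a saturated level obeys
  `(c₀ν)² 2^j ≤ C ∫ |G|²`, hence `exists_dissipationWavenumber_mul_le`:
  `(c₀ν)² Λ(v) ≤ (c₀ν)² + C ∫ |G|²`;
* `IsLerayHopfOn.exists_measurable_dissipation` — the dissipation `t ↦ ∫ |∇u(t)|²` of a Leray–Hopf
  solution as a time-measurable function with `∫₀ᵀ ≤ E(u₀)/ν` (jointly measurable weak gradient of
  `IsLerayHopfOn.exists_measurable_weakGradient` + the energy inequality), and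
  `IsLerayHopfOn.ae_dissipationWavenumber_lt_top` (`Λ(u(t)) < ∞` for a.e. `t`, §4);
* `exists_mul_lintegral_dissipationWavenumber_le` (**Lemma 4.1**, quantitative):
  `(c₀ν)² ∫₀ᵀ Λ(u(t)) dt ≤ (c₀ν)² T + C E(u₀)/ν` for every Leray–Hopf solution on `ℝ³ × [0,T)`,
  `ν > 0`, and `exists_lintegral_dissipationWavenumber_le`: `∫₀ᵀ Λ ≤ T + C E(u₀)/(c₀²ν³)` for
  `c₀ > 0` (lower Lebesgue integrals in time; no measurability of `t ↦ Λ(u(t))` is asserted or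
  needed);
* `exists_two_pow_mul_volume_setOf_saturated_le`, `IsLerayHopfOn.exists_two_pow_mul_volume_le`
  — the weak-`L¹` (Chebyshev) form on the level sets: `2^n · |{t ∈ (0,T) | ∃ j > n saturated}| ≤ A`
  for all `n`, with `A` depending on `c₀, ν, E(u₀)` only;
* `regular_of_dissipationWavenumber_le` — the `L^∞` end of the ladder: fed the named statement
  `cheskidov_shvydkoy_dyadic` (Cheskidov–Shvydkoy 2010, Lemma 3.2; discharged in the tree), a
  Leray–Hopf solution with `sup_{t ∈ (0,T)} Λ_c(u(t)) < ∞` is regular on `(0,T]` ("this regularity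
  condition can be restated as `Λ ∈ L^∞(0,T)`", §4).

## References

* A. Cheskidov, R. Shvydkoy, J. Math. Fluid Mech. 16 (2014) 263–273 = arXiv:1102.1944, §3
  (definition of `Λ`), Lemma 4.1, p. 7. [CheskidovShvydkoy2011]
* A. Cheskidov, R. Shvydkoy, Arch. Ration. Mech. Anal. 195 (2010) 159–169, Lemma 3.2.
  [CheskidovShvydkoy2010]
* H. Bahouri, J.-Y. Chemin, R. Danchin, *Fourier Analysis and Nonlinear PDE* (2011), Lemma 2.1
  (Bernstein). [BahouriCheminDanchin2011]
-/

noncomputable section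

open MeasureTheory Filter Set Function
open scoped ENNReal NNReal SchwartzMap LineDeriv

namespace Literature.Analysis.FluidPDE

open FunctionSpaces

/-! ## The dissipation wavenumber of a slice -/

section Definition

variable {E : Type*} [NormedAddCommGroup E] [InnerProductSpace ℝ E] [FiniteDimensional ℝ E]
  [MeasurableSpace E] [BorelSpace E]
variable {E' : Type*} [NormedAddCommGroup E'] [NormedSpace ℝ E']

/-- **Saturated dyadic level** of a slice `v` at threshold `c₀` and viscosity `ν`:
`c₀ ν 2^j ≤ ‖Δ̇_j v‖_{L^∞}`, i.e. the level Reynolds number `‖Δ̇_j v‖_∞ /(ν 2^j)` reaches `c₀`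
(Cheskidov–Shvydkoy, §3: the complement of `λ_p⁻¹‖u_p‖_∞ < c₀ν`). Spelled as in route
`WeakLambdaEndpoint`. [cite: CheskidovShvydkoy2011, §3 (definition of Λ)] -/
def IsSaturatedLevel (c₀ ν : ℝ) (v : E → E') (j : ℕ) : Prop :=
  ENNReal.ofReal (c₀ * ν) * 2 ^ j ≤ eLpNorm (blockFn (j : ℤ) v) ∞ volume

/-- **The Cheskidov–Shvydkoy dissipation wavenumber** of a slice `v`:
`Λ(v) = min{2^q : level p unsaturated for all p > q, q ≥ 0} = 1 ⊔ sup{2^j : j saturated} ∈ [1, ∞]`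
(`= 2^Q` for the top saturated level `Q`, `= 1` if no level `j ≥ 1` is saturated, `= ∞` if
infinitely many are). [cite: CheskidovShvydkoy2011, §3 (definition of Λ)] -/
def dissipationWavenumber (c₀ ν : ℝ) (v : E → E') : ℝ≥0∞ :=
  1 ⊔ ⨆ (j : ℕ) (_ : IsSaturatedLevel c₀ ν v j), (2 : ℝ≥0∞) ^ j

/-- Unfolding the saturation predicate. [cite: CheskidovShvydkoy2011, §3 (definition of Λ)] -/
theorem isSaturatedLevel_iff (c₀ ν : ℝ) (v : E → E') (j : ℕ) :
    IsSaturatedLevel c₀ ν v j ↔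
      ENNReal.ofReal (c₀ * ν) * 2 ^ j ≤ eLpNorm (blockFn (j : ℤ) v) ∞ volume :=
  Iff.rfl

/-- `Λ ≥ 1 = λ₀` (the minimum in the definition runs over `q ≥ 0`). [cite: CheskidovShvydkoy2011, §3 (definition of Λ)] -/
theorem one_le_dissipationWavenumber (c₀ ν : ℝ) (v : E → E') :
    1 ≤ dissipationWavenumber c₀ ν v :=
  le_sup_left

/-- A saturated level lies below the dissipation wavenumber: `2^j ≤ Λ(v)`
(Cheskidov–Shvydkoy, §3, `‖u_{Q(t)}‖_∞ ≥ c₀νΛ(t)`: `Λ` is the top saturated frequency). [cite: CheskidovShvydkoy2011, §3 (definition of Λ)] -/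
theorem two_pow_le_dissipationWavenumber {c₀ ν : ℝ} {v : E → E'} {j : ℕ}
    (hj : IsSaturatedLevel c₀ ν v j) : (2 : ℝ≥0∞) ^ j ≤ dissipationWavenumber c₀ ν v :=
  le_sup_of_le_right (le_iSup₂_of_le (f := fun (j : ℕ) (_ : IsSaturatedLevel c₀ ν v j) => (2 : ℝ≥0∞) ^ j)
    j hj le_rfl)

/-- If some level above `n` is saturated then `2^(n+1) ≤ Λ(v)`, i.e. `Λ(v) > 2^n`: the level sets
`{∃ j > n saturated}` of route `WeakLambdaEndpoint` are the sets `{Λ > 2^n}`. [cite: CheskidovShvydkoy2011, §3 (definition of Λ)] -/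
theorem two_pow_succ_le_dissipationWavenumber {c₀ ν : ℝ} {v : E → E'} {n : ℕ}
    (h : ∃ j : ℕ, n < j ∧ IsSaturatedLevel c₀ ν v j) :
    (2 : ℝ≥0∞) ^ (n + 1) ≤ dissipationWavenumber c₀ ν v := by
  obtain ⟨j, hnj, hj⟩ := h
  exact (pow_le_pow_right₀ one_le_two (Nat.succ_le_of_lt hnj)).trans (two_pow_le_dissipationWavenumber hj)

/-- **Bounding `Λ` from above**: if every saturated level has `2^j ≤ M` and `1 ≤ M`, then
`Λ(v) ≤ M`. [cite: CheskidovShvydkoy2011, §3 (definition of Λ)] -/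
theorem dissipationWavenumber_le {c₀ ν : ℝ} {v : E → E'} {M : ℝ≥0∞} (h1 : 1 ≤ M)
    (h : ∀ j : ℕ, IsSaturatedLevel c₀ ν v j → (2 : ℝ≥0∞) ^ j ≤ M) :
    dissipationWavenumber c₀ ν v ≤ M :=
  sup_le h1 (iSup₂_le h)

/-- Saturation is antitone in the threshold: a level saturated at threshold `c₀'` is saturated at
every smaller threshold `c₀ ≤ c₀'` (for `ν ≥ 0`). [cite: CheskidovShvydkoy2011, §3 (definition of Λ)] -/
theorem IsSaturatedLevel.anti {c₀ c₀' ν : ℝ} {v : E → E'} {j : ℕ} (h : IsSaturatedLevel c₀' ν v j)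
    (hc : c₀ ≤ c₀') (hν : 0 ≤ ν) : IsSaturatedLevel c₀ ν v j :=
  le_trans (mul_le_mul' (ENNReal.ofReal_le_ofReal (mul_le_mul_of_nonneg_right hc hν)) le_rfl) h

/-- **`Λ` is antitone in the threshold** (route `WeakLambdaEndpoint`: "X1 is antitone in c₀"):
`c₀ ≤ c₀'` implies `Λ_{c₀'}(v) ≤ Λ_{c₀}(v)` for `ν ≥ 0`. [cite: CheskidovShvydkoy2011, §3 (definition of Λ)] -/
theorem dissipationWavenumber_anti {c₀ c₀' ν : ℝ} (hc : c₀ ≤ c₀') (hν : 0 ≤ ν) (v : E → E') :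
    dissipationWavenumber c₀' ν v ≤ dissipationWavenumber c₀ ν v :=
  dissipationWavenumber_le (one_le_dissipationWavenumber _ _ _)
    fun _ hj => two_pow_le_dissipationWavenumber (hj.anti hc hν)

/-- In `[0,∞]`, `2^n < 2^(n+1)`. [folklore] -/
private theorem two_pow_lt_two_pow_succ_ennreal (n : ℕ) : (2 : ℝ≥0∞) ^ n < 2 ^ (n + 1) := by
  have h : ((2 ^ n : ℕ) : ℝ≥0∞) < ((2 ^ (n + 1) : ℕ) : ℝ≥0∞) :=
    Nat.cast_lt.2 (Nat.pow_lt_pow_right (by norm_num) (Nat.lt_succ_self n))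
  simpa using h

/-- **Converse of `two_pow_succ_le_dissipationWavenumber`**: if `2^(n+1) ≤ Λ(v)` then some level
`j > n` is saturated (the definition: `Λ = 1 ⊔ sup_{saturated j} 2^j`, and a supremum of powers `2^j`,
`j ≤ n`, is at most `2^n`). [cite: CheskidovShvydkoy2011, §3 (definition of Λ)] -/
theorem exists_isSaturatedLevel_of_two_pow_succ_le {c₀ ν : ℝ} {v : E → E'} {n : ℕ}
    (h : (2 : ℝ≥0∞) ^ (n + 1) ≤ dissipationWavenumber c₀ ν v) :
    ∃ j : ℕ, n < j ∧ IsSaturatedLevel c₀ ν v j := by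
  by_contra hcon
  push Not at hcon
  -- every saturated level is `≤ n`, so `Λ ≤ 2^n < 2^(n+1)`
  have hle : dissipationWavenumber c₀ ν v ≤ (2 : ℝ≥0∞) ^ n :=
    dissipationWavenumber_le (one_le_pow₀ one_le_two) fun j hj =>
      pow_le_pow_right₀ one_le_two (not_lt.1 fun hnj => hcon j hnj hj)
  exact (lt_irrefl _) ((h.trans hle).trans_lt (two_pow_lt_two_pow_succ_ennreal n))

/-- **The level sets of `Λ` are the sets "some level above `n` is saturated"**:
`2^(n+1) ≤ Λ(v) ↔ ∃ j > n saturated` — the identification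
`{Λ > 2^n} = {∃ j > n saturated}` used by route `WeakLambdaEndpoint` and by the FluidComputer
occupation/residence sets, now in both directions. [cite: CheskidovShvydkoy2011, §3 (definition of Λ)] -/
theorem two_pow_succ_le_dissipationWavenumber_iff (c₀ ν : ℝ) (v : E → E') (n : ℕ) :
    (2 : ℝ≥0∞) ^ (n + 1) ≤ dissipationWavenumber c₀ ν v ↔ ∃ j : ℕ, n < j ∧ IsSaturatedLevel c₀ ν v j :=
  ⟨exists_isSaturatedLevel_of_two_pow_succ_le, two_pow_succ_le_dissipationWavenumber⟩

/-- `2^q ≤ Λ(v)` iff `q = 0` or some level `j ≥ q` is saturated (`Λ ≥ 1` always). [cite: CheskidovShvydkoy2011, §3 (definition of Λ)] -/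
theorem two_pow_le_dissipationWavenumber_iff (c₀ ν : ℝ) (v : E → E') (q : ℕ) :
    (2 : ℝ≥0∞) ^ q ≤ dissipationWavenumber c₀ ν v ↔
      q = 0 ∨ ∃ j : ℕ, q ≤ j ∧ IsSaturatedLevel c₀ ν v j := by
  rcases q with _ | n
  · simp [one_le_dissipationWavenumber]
  · rw [two_pow_succ_le_dissipationWavenumber_iff]
    simp only [Nat.succ_ne_zero, false_or, Nat.succ_le_iff]

/-- **`Λ(v) = ∞` iff infinitely many levels are saturated** (for every `n` some level `j > n` is
saturated) — the case "`Λ(t) = ∞` if there are infinitely many [saturated levels]" of the definition. [cite: CheskidovShvydkoy2011, §3 (definition of Λ)] -/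
theorem dissipationWavenumber_eq_top_iff (c₀ ν : ℝ) (v : E → E') :
    dissipationWavenumber c₀ ν v = ∞ ↔ ∀ n : ℕ, ∃ j : ℕ, n < j ∧ IsSaturatedLevel c₀ ν v j := by
  refine ⟨fun h n => exists_isSaturatedLevel_of_two_pow_succ_le (h ▸ le_top), fun h => ?_⟩
  refine ENNReal.eq_top_of_forall_nnreal_le fun r => ?_
  calc (r : ℝ≥0∞) ≤ (⌈r⌉₊ : ℕ) := by exact_mod_cast Nat.le_ceil r
    _ ≤ ((2 ^ ⌈r⌉₊ : ℕ) : ℝ≥0∞) := by exact_mod_cast (Nat.lt_two_pow_self).le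
    _ = (2 : ℝ≥0∞) ^ ⌈r⌉₊ := by push_cast; rfl
    _ ≤ (2 : ℝ≥0∞) ^ (⌈r⌉₊ + 1) := pow_le_pow_right₀ one_le_two (Nat.le_succ _)
    _ ≤ dissipationWavenumber c₀ ν v := two_pow_succ_le_dissipationWavenumber (h ⌈r⌉₊)

/-- `Λ(v) < ∞` iff the saturated levels are bounded: some `n` has no saturated level above it. [cite: CheskidovShvydkoy2011, §3 (definition of Λ)] -/
theorem dissipationWavenumber_lt_top_iff (c₀ ν : ℝ) (v : E → E') :
    dissipationWavenumber c₀ ν v < ∞ ↔ ∃ n : ℕ, ∀ j : ℕ, n < j → ¬ IsSaturatedLevel c₀ ν v j := by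
  rw [lt_top_iff_ne_top, Ne, dissipationWavenumber_eq_top_iff]
  push Not
  rfl

end Definition

/-! ## Dictionary: saturation in the distribution-level weights of `cheskidov_shvydkoy_dyadic` -/

section Dictionary

variable {ι : Type*} [Fintype ι]
variable {E : Type*} [NormedAddCommGroup E] [InnerProductSpace ℝ E] [FiniteDimensional ℝ E]
  [MeasurableSpace E] [BorelSpace E]

/-- **Saturation through the distribution of the slice.** For an `L^p` field `v` with tempered
distribution `V`, level `j` is saturated iff `c₀ν ≤ 2^{-j} ‖Δ̇_j V‖_∞ = lpBlockWeight (-1) ∞ V j` — the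
weight in which the tree states Cheskidov–Shvydkoy 2010's Lemma 3.2 (`cheskidov_shvydkoy_dyadic`) and
the FluidComputer floors (`LevelReynoldsFloor`) are phrased (`IsDistributionOf.lpBlockWeight_top_eq`).
[cite: CheskidovShvydkoy2011, §3 (definition of Λ)] -/
theorem isSaturatedLevel_iff_le_lpBlockWeight {p : ℝ≥0∞} [Fact (1 ≤ p)] {v : E → EuclideanSpace ℝ ι}
    {V : 𝓢'(E, EuclideanSpace ℂ ι)} (hV : IsDistributionOf v V) (hv : MemLp v p volume)
    (c₀ ν : ℝ) (j : ℕ) :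
    IsSaturatedLevel c₀ ν v j ↔
      ENNReal.ofReal (c₀ * ν) ≤ FunctionSpaces.lpBlockWeight (-1) ∞ V (j : ℤ) := by
  have h0 : (2 : ℝ≥0∞) ^ (((j : ℤ) : ℝ) * (-1 : ℝ)) ≠ 0 := by
    rw [Ne, ENNReal.rpow_eq_zero_iff]; norm_num
  have hinf : (2 : ℝ≥0∞) ^ (((j : ℤ) : ℝ) * (-1 : ℝ)) ≠ ∞ := by
    rw [Ne, ENNReal.rpow_eq_top_iff]; norm_num
  have hexp : ((j : ℤ) : ℝ) * (-1 : ℝ) + (j : ℕ) = 0 := by push_cast; ring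
  have hpow : (2 : ℝ≥0∞) ^ (((j : ℤ) : ℝ) * (-1 : ℝ)) * (2 : ℝ≥0∞) ^ j = 1 := by
    rw [← ENNReal.rpow_natCast, ← ENNReal.rpow_add _ _ (by norm_num) (by norm_num), hexp,
      ENNReal.rpow_zero]
  rw [hV.lpBlockWeight_top_eq hv (-1) (j : ℤ), isSaturatedLevel_iff,
    ← ENNReal.mul_le_mul_iff_right h0 hinf]
  have hl : (2 : ℝ≥0∞) ^ (((j : ℤ) : ℝ) * (-1 : ℝ)) * (ENNReal.ofReal (c₀ * ν) * 2 ^ j) =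
      ENNReal.ofReal (c₀ * ν) := by
    rw [mul_comm (ENNReal.ofReal _), ← mul_assoc, hpow, one_mul]
  rw [hl]

end Dictionary

/-! ## The Bernstein step: block sup norms of Sobolev slices on `ℝ³` -/

section Slice

/-- **Block sup norms against the dissipation** (the Bernstein step of Cheskidov–Shvydkoy's proof of
Lemma 4.1, `‖u_p‖_∞ ≤ λ_p^{3/2}‖u_p‖₂` combined with `λ_p‖u_p‖₂ ≲ ‖∇u‖₂`, for Sobolev slices): there
is an absolute `C` such that for every `v ∈ L²(ℝ³)` with a weak gradient `G` of finite dissipation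
and every level `j`, `‖Δ̇_j v‖_{L^∞} ≤ C · 2^{j/2} · (∫ |G|²)^{1/2}`. Assembled from the tree's
distribution-level Bernstein inequality (`FunctionSpaces.exists_eLpNormDistrib_lpBlock_le`, BCD
Lemma 2.1), reverse Bernstein inequality (`exists_eLpNormDistrib_lpBlock_le_sum_lineDeriv`, Danchin
Prop. 2.1) and the identification of `∂ᵢ` of the distribution of `v` with the distribution of the
weak partial derivative (`IsDistributionOf.lineDeriv_of_hasWeakGradient_of_memLp`). [cite: CheskidovShvydkoy2011, Lemma 4.1 (proof)] -/
theorem exists_eLpNorm_top_blockFn_le_two_rpow_mul_dissipation :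
    ∃ C : ℝ≥0, ∀ (j : ℕ) (v : EuclideanSpace ℝ (Fin 3) → EuclideanSpace ℝ (Fin 3))
      (G : EuclideanSpace ℝ (Fin 3) → EuclideanSpace ℝ (Fin 3) →L[ℝ] EuclideanSpace ℝ (Fin 3)),
      MemLp v 2 volume → HasWeakGradient v G →
      (∫⁻ x, ENNReal.ofReal (frobeniusNormSq (G x))) < ∞ →
      eLpNorm (blockFn (j : ℤ) v) ∞ volume ≤
        C * (2 : ℝ≥0∞) ^ ((j : ℝ) / 2) * (∫⁻ x, ENNReal.ofReal (frobeniusNormSq (G x))) ^ (1 / 2 : ℝ) := by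
  classical
  -- the three Littlewood–Paley constants
  obtain ⟨CB, -, hCB⟩ := FunctionSpaces.exists_eLpNormDistrib_lpBlock_le
    (E := EuclideanSpace ℝ (Fin 3)) (F := EuclideanSpace ℂ (Fin 3)) 2 ∞ le_top
  set b := stdOrthonormalBasis ℝ (EuclideanSpace ℝ (Fin 3)) with hb
  obtain ⟨CR, hCR⟩ := exists_eLpNormDistrib_lpBlock_le_sum_lineDeriv
    (E := EuclideanSpace ℝ (Fin 3)) (F := EuclideanSpace ℂ (Fin 3)) 2 b
  obtain ⟨CA, hCA⟩ := exists_eLpNormDistrib_lpBlock_le_eLpNormDistrib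
    (E := EuclideanSpace ℝ (Fin 3)) (F := EuclideanSpace ℂ (Fin 3)) 2
  refine ⟨CB * CR * (Fintype.card (Fin (Module.finrank ℝ (EuclideanSpace ℝ (Fin 3)))) * CA),
    fun j v G hv hG hD => ?_⟩
  -- the distribution of `v` and the dictionary for the block
  have hW := isDistributionOf_toTemperedDistribution (ι := Fin 3) hv
  set W : 𝓢'(EuclideanSpace ℝ (Fin 3), EuclideanSpace ℂ (Fin 3)) :=
    Lp.toTemperedDistribution ((memLp_complexify_comp hv).toLp _) with hWdef
  have htop : MemLp (blockFn (j : ℤ) v) ∞ volume := memLp_top_blockFn (j : ℤ) hv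
  rw [← hW.eLpNormDistrib_lpBlock_eq hv (j : ℤ) htop]
  -- the dissipation dominates each weak partial derivative in `L²`
  set D : ℝ≥0∞ := ∫⁻ x, ENNReal.ofReal (frobeniusNormSq (G x)) with hDdef
  have hGmeas : AEStronglyMeasurable G volume := hG.locallyIntegrable_grad.aestronglyMeasurable
  have hGi : ∀ i, eLpNorm (fun x => G x (b i)) 2 volume ≤ D ^ (1 / 2 : ℝ) := by
    intro i
    have hsq : eLpNorm (fun x => G x (b i)) 2 volume ^ 2 ≤ D := by
      rw [eLpNorm_two_sq_eq_lintegral]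
      refine lintegral_mono fun x => ?_
      rw [← ofReal_norm, ← ENNReal.ofReal_pow (norm_nonneg _)]
      exact ENNReal.ofReal_le_ofReal (norm_apply_sq_le_frobeniusNormSq b (G x) i)
    calc eLpNorm (fun x => G x (b i)) 2 volume
        = (eLpNorm (fun x => G x (b i)) 2 volume ^ 2) ^ (1 / 2 : ℝ) := by
          rw [← ENNReal.rpow_natCast, ← ENNReal.rpow_mul]; norm_num
      _ ≤ D ^ (1 / 2 : ℝ) := by gcongr
  have hGi_mem : ∀ i, MemLp (fun x => G x (b i)) 2 volume := by
    intro i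
    refine ⟨(ContinuousLinearMap.apply ℝ (EuclideanSpace ℝ (Fin 3)) (b i)).continuous.comp_aestronglyMeasurable hGmeas, ?_⟩
    exact (hGi i).trans_lt (ENNReal.rpow_lt_top_of_nonneg (by norm_num) hD.ne)
  -- `∂_{b i} W` is the distribution of `G · b i`, so its `L²` norm is that of `G · b i`
  have hder : ∀ i, eLpNormDistrib 2 (∂_{b i} W) = eLpNorm (fun x => G x (b i)) 2 volume := fun i =>
    (hW.lineDeriv_of_hasWeakGradient_of_memLp hG (b i) (hGi_mem i)).eLpNormDistrib_eq (hGi_mem i)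
  -- assemble
  have hexp : ((j : ℤ) : ℝ) * Module.finrank ℝ (EuclideanSpace ℝ (Fin 3)) *
      ((2 : ℝ≥0∞).toReal⁻¹ - (∞ : ℝ≥0∞).toReal⁻¹) = 3 * (j : ℝ) / 2 := by
    simp; ring
  have h2 : (2 : ℝ≥0∞) ^ (3 * (j : ℝ) / 2) * (2 : ℝ≥0∞) ^ (-((j : ℤ) : ℝ)) = (2 : ℝ≥0∞) ^ ((j : ℝ) / 2) := by
    rw [← ENNReal.rpow_add _ _ (by norm_num) (by norm_num)]
    congr 1
    push_cast
    ring
  calc eLpNormDistrib ∞ (lpBlock (j : ℤ) W)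
      ≤ CB * (2 : ℝ≥0∞) ^ (((j : ℤ) : ℝ) * Module.finrank ℝ (EuclideanSpace ℝ (Fin 3)) *
          ((2 : ℝ≥0∞).toReal⁻¹ - (∞ : ℝ≥0∞).toReal⁻¹)) * eLpNormDistrib 2 (lpBlock (j : ℤ) W) := hCB _ W
    _ = CB * (2 : ℝ≥0∞) ^ (3 * (j : ℝ) / 2) * eLpNormDistrib 2 (lpBlock (j : ℤ) W) := by rw [hexp]
    _ ≤ CB * (2 : ℝ≥0∞) ^ (3 * (j : ℝ) / 2) *
          (CR * (2 : ℝ≥0∞) ^ (-((j : ℤ) : ℝ)) * ∑ i, eLpNormDistrib 2 (lpBlock (j : ℤ) (∂_{b i} W))) := by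
        gcongr; exact hCR _ W
    _ ≤ CB * (2 : ℝ≥0∞) ^ (3 * (j : ℝ) / 2) *
          (CR * (2 : ℝ≥0∞) ^ (-((j : ℤ) : ℝ)) * ∑ i : Fin (Module.finrank ℝ (EuclideanSpace ℝ (Fin 3))), CA * D ^ (1 / 2 : ℝ)) := by
        gcongr with i
        calc eLpNormDistrib 2 (lpBlock (j : ℤ) (∂_{b i} W))
            ≤ CA * eLpNormDistrib 2 (∂_{b i} W) := hCA _ _
          _ = CA * eLpNorm (fun x => G x (b i)) 2 volume := by rw [hder i]
          _ ≤ CA * D ^ (1 / 2 : ℝ) := by gcongr; exact hGi i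
    _ = ((CB * CR * (Fintype.card (Fin (Module.finrank ℝ (EuclideanSpace ℝ (Fin 3)))) * CA) : ℝ≥0) : ℝ≥0∞) *
          (2 : ℝ≥0∞) ^ ((j : ℝ) / 2) * D ^ (1 / 2 : ℝ) := by
        rw [Finset.sum_const, Finset.card_univ, ← h2]
        push_cast
        ring

/-- **A saturated level is paid for by the dissipation**: with the constant of
`exists_eLpNorm_top_blockFn_le_two_rpow_mul_dissipation`, if `c₀ ν 2^j ≤ ‖Δ̇_j v‖_∞` for an `L²`
slice `v` with weak gradient `G` of finite dissipation, then `(c₀ν)² 2^j ≤ C² ∫ |G|²` (square the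
Bernstein bound and cancel `2^j`; this is the line `c₀ν Λ ≤ Λ⁻¹‖u_Q‖²_∞ ≤ Λ²‖u_Q‖²₂` of the printed
proof, slice by slice). [cite: CheskidovShvydkoy2011, Lemma 4.1 (proof)] -/
theorem exists_two_pow_mul_le_dissipation_of_saturated :
    ∃ C : ℝ≥0, ∀ (c₀ ν : ℝ) (j : ℕ) (v : EuclideanSpace ℝ (Fin 3) → EuclideanSpace ℝ (Fin 3))
      (G : EuclideanSpace ℝ (Fin 3) → EuclideanSpace ℝ (Fin 3) →L[ℝ] EuclideanSpace ℝ (Fin 3)),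
      MemLp v 2 volume → HasWeakGradient v G →
      (∫⁻ x, ENNReal.ofReal (frobeniusNormSq (G x))) < ∞ →
      IsSaturatedLevel c₀ ν v j →
      ENNReal.ofReal (c₀ * ν) ^ 2 * 2 ^ j ≤ C * ∫⁻ x, ENNReal.ofReal (frobeniusNormSq (G x)) := by
  obtain ⟨C, hC⟩ := exists_eLpNorm_top_blockFn_le_two_rpow_mul_dissipation
  refine ⟨C ^ 2, fun c₀ ν j v G hv hG hD hsat => ?_⟩
  set D : ℝ≥0∞ := ∫⁻ x, ENNReal.ofReal (frobeniusNormSq (G x)) with hDdef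
  set a : ℝ≥0∞ := ENNReal.ofReal (c₀ * ν) with ha
  -- `a 2^j ≤ C 2^{j/2} D^{1/2}`, squared
  have h1 : a * 2 ^ j ≤ C * (2 : ℝ≥0∞) ^ ((j : ℝ) / 2) * D ^ (1 / 2 : ℝ) :=
    le_trans hsat (hC j v G hv hG hD)
  have h2 : (a * 2 ^ j) ^ 2 ≤ (C * (2 : ℝ≥0∞) ^ ((j : ℝ) / 2) * D ^ (1 / 2 : ℝ)) ^ 2 :=
    pow_le_pow_left' h1 2
  have hhalf : ((2 : ℝ≥0∞) ^ ((j : ℝ) / 2)) ^ 2 = 2 ^ j := by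
    rw [← ENNReal.rpow_natCast, ← ENNReal.rpow_mul]
    norm_num
  have hDsq : (D ^ (1 / 2 : ℝ)) ^ 2 = D := by
    rw [← ENNReal.rpow_natCast, ← ENNReal.rpow_mul]
    norm_num
  have h3 : a ^ 2 * 2 ^ j * 2 ^ j ≤ (C : ℝ≥0∞) ^ 2 * D * 2 ^ j := by
    calc a ^ 2 * 2 ^ j * 2 ^ j = (a * 2 ^ j) ^ 2 := by ring
      _ ≤ (C * (2 : ℝ≥0∞) ^ ((j : ℝ) / 2) * D ^ (1 / 2 : ℝ)) ^ 2 := h2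
      _ = (C : ℝ≥0∞) ^ 2 * ((2 : ℝ≥0∞) ^ ((j : ℝ) / 2)) ^ 2 * (D ^ (1 / 2 : ℝ)) ^ 2 := by ring
      _ = (C : ℝ≥0∞) ^ 2 * D * 2 ^ j := by rw [hhalf, hDsq]; ring
  have hne0 : (2 : ℝ≥0∞) ^ j ≠ 0 := pow_ne_zero _ two_ne_zero
  have hnet : (2 : ℝ≥0∞) ^ j ≠ ∞ := ENNReal.pow_ne_top ENNReal.ofNat_ne_top
  have h4 : a ^ 2 * 2 ^ j ≤ (C : ℝ≥0∞) ^ 2 * D := (ENNReal.mul_le_mul_iff_left hne0 hnet).1 h3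
  simpa only [ENNReal.coe_pow] using h4

/-- **Slice bound for `Λ`**: with the same constant, `(c₀ν)² Λ(v) ≤ (c₀ν)² + C ∫ |G|²` for every
`L²` slice `v` on `ℝ³` with weak gradient `G` of finite dissipation (every saturated level has
`(c₀ν)² 2^j ≤ C ∫|G|²`, and `Λ = 1 ⊔ sup` over them). [cite: CheskidovShvydkoy2011, Lemma 4.1 (proof)] -/
theorem exists_dissipationWavenumber_mul_le :
    ∃ C : ℝ≥0, ∀ (c₀ ν : ℝ) (v : EuclideanSpace ℝ (Fin 3) → EuclideanSpace ℝ (Fin 3))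
      (G : EuclideanSpace ℝ (Fin 3) → EuclideanSpace ℝ (Fin 3) →L[ℝ] EuclideanSpace ℝ (Fin 3)),
      MemLp v 2 volume → HasWeakGradient v G →
      (∫⁻ x, ENNReal.ofReal (frobeniusNormSq (G x))) < ∞ →
      ENNReal.ofReal (c₀ * ν) ^ 2 * dissipationWavenumber c₀ ν v ≤
        ENNReal.ofReal (c₀ * ν) ^ 2 + C * ∫⁻ x, ENNReal.ofReal (frobeniusNormSq (G x)) := by
  obtain ⟨C, hC⟩ := exists_two_pow_mul_le_dissipation_of_saturated
  refine ⟨C, fun c₀ ν v G hv hG hD => ?_⟩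
  set D : ℝ≥0∞ := ∫⁻ x, ENNReal.ofReal (frobeniusNormSq (G x)) with hDdef
  set a : ℝ≥0∞ := ENNReal.ofReal (c₀ * ν) with ha
  set S : ℝ≥0∞ := ⨆ (j : ℕ) (_ : IsSaturatedLevel c₀ ν v j), (2 : ℝ≥0∞) ^ j with hS
  have hSle : a ^ 2 * S ≤ C * D := by
    rw [hS, ENNReal.mul_iSup]
    refine iSup_le fun j => ?_
    rw [ENNReal.mul_iSup]
    exact iSup_le fun hj => hC c₀ ν j v G hv hG hD hj
  change a ^ 2 * (1 ⊔ S) ≤ a ^ 2 + C * D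
  rcases le_total 1 S with h | h
  · rw [sup_eq_right.2 h]
    exact hSle.trans le_add_self
  · rw [sup_eq_left.2 h, mul_one]
    exact le_self_add

end Slice

/-! ## Lemma 4.1: `Λ ∈ L¹(0,T)` for every Leray–Hopf solution -/

section LerayHopf

variable {ν T : ℝ} {u₀ : EuclideanSpace ℝ (Fin 3) → EuclideanSpace ℝ (Fin 3)}
  {u : ℝ → EuclideanSpace ℝ (Fin 3) → EuclideanSpace ℝ (Fin 3)}

/-- **The dissipation of a Leray–Hopf solution, measurably in time.** For a Leray–Hopf solution on
`ℝ³ × [0,T)` with `ν > 0`, `T > 0` and zero force there is a time-measurable function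
`m : ℝ → [0,∞]` with `∫₀ᵀ m ≤ E(u₀)/ν` such that for a.e. `t ∈ (0,T)` the slice `u t` has a weak
gradient `G t` with `∫ |G t|² = m t < ∞` (the jointly measurable weak gradient of
`IsLerayHopfOn.exists_measurable_weakGradient`, identified a.e. with the gradient of the energy
inequality by uniqueness of weak gradients; the energy inequality from `s = 0` at `t = T`,
`ν ∫₀ᵀ ‖∇u‖₂² ≤ ½‖u₀‖₂²`, Leray 1934, §31, (5.2)). [cite: Leray1934, §31 eq. (5.2)] -/
theorem IsLerayHopfOn.exists_measurable_dissipation (hLH : IsLerayHopfOn T ν 0 u₀ u) (hν : 0 < ν)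
    (hT : 0 < T) :
    ∃ (m : ℝ → ℝ≥0∞) (G : ℝ → EuclideanSpace ℝ (Fin 3) →
        EuclideanSpace ℝ (Fin 3) →L[ℝ] EuclideanSpace ℝ (Fin 3)), Measurable m ∧
      (∀ᵐ t ∂(volume.restrict (Ioo 0 T)), HasWeakGradient (u t) (G t) ∧
        (∫⁻ x, ENNReal.ofReal (frobeniusNormSq (G t x))) = m t ∧ m t < ∞) ∧
      ∫⁻ t in Ioo 0 T, m t ≤ ENNReal.ofReal (VectorCalculus.kineticEnergy u₀ / ν) := by
  obtain ⟨G, hG, hGint, hE0, -⟩ := hLH.weakGrad_energy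
  obtain ⟨G', hG'm, hG', -, -⟩ := hLH.exists_measurable_weakGradient
  set m : ℝ → ℝ≥0∞ := fun s => ∫⁻ x, ENNReal.ofReal (frobeniusNormSq (G' s x)) with hm
  have hmeas : Measurable m := by
    have h : Measurable fun z : ℝ × EuclideanSpace ℝ (Fin 3) =>
        ENNReal.ofReal (frobeniusNormSq (uncurry G' z)) :=
      ENNReal.measurable_ofReal.comp
        (LerayHopfProofs.continuous_frobeniusNormSq.comp_stronglyMeasurable hG'm).measurable
    exact h.lintegral_prod_right'
  -- the two gradients agree a.e. in space for a.e. time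
  have hGG' : ∀ᵐ t ∂(volume.restrict (Ioo 0 T)),
      (∫⁻ x, ENNReal.ofReal (frobeniusNormSq (G t x))) = m t := by
    filter_upwards [hG, hG'] with t hGt hG't
    have heq : G t =ᵐ[volume] G' t := by
      have := FunctionSpaces.HasWeakFDerivOn.unique_holds hGt hG't
      simpa [Measure.restrict_univ] using this
    refine lintegral_congr_ae ?_
    filter_upwards [heq] with x hx
    rw [hx]
  have hint_eq : ∫⁻ t in Ioo 0 T, m t =
      ∫⁻ t in Ioo 0 T, ∫⁻ x, ENNReal.ofReal (frobeniusNormSq (G t x)) :=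
    lintegral_congr_ae (hGG'.mono fun t ht => ht.symm)
  -- the energy inequality from `0` at `t = T`
  have hbound : ∫⁻ t in Ioo 0 T, m t ≤ ENNReal.ofReal (VectorCalculus.kineticEnergy u₀ / ν) := by
    rw [hint_eq]
    have h := hE0 T ⟨hT.le, le_rfl⟩
    simp only [Pi.zero_apply, inner_zero_left, integral_zero, intervalIntegral.integral_zero,
      add_zero] at h
    have hfin : (∫⁻ t in Ioo 0 T, ∫⁻ x, ENNReal.ofReal (frobeniusNormSq (G t x))) ≠ ∞ := hGint.ne
    have hreal : (∫⁻ t in Ioo 0 T, ∫⁻ x, ENNReal.ofReal (frobeniusNormSq (G t x))).toReal ≤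
        VectorCalculus.kineticEnergy u₀ / ν := by
      rw [le_div_iff₀ hν]
      linarith [kineticEnergy_nonneg (u T), mul_comm ν
        (∫⁻ t in Ioo 0 T, ∫⁻ x, ENNReal.ofReal (frobeniusNormSq (G t x))).toReal]
    exact (ENNReal.le_ofReal_iff_toReal_le hfin
      (div_nonneg (kineticEnergy_nonneg u₀) hν.le)).2 hreal
  refine ⟨m, G', hmeas, ?_, hbound⟩
  have hfin_ae : ∀ᵐ t ∂(volume.restrict (Ioo 0 T)), m t < ∞ :=
    ae_lt_top hmeas (lt_of_le_of_lt hbound ENNReal.ofReal_lt_top).ne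
  filter_upwards [hG', hfin_ae] with t hG't hfin
  exact ⟨hG't, rfl, hfin⟩

/-- **`Λ(t) < ∞` for a.e. `t`** ("Note that `Λ(t) < ∞` a.e. for every Leray-Hopf solution", Cheskidov–Shvydkoy
2014, §4, before Lemma 4.1): for a Leray–Hopf solution on `ℝ³ × [0,T)` with `ν > 0` and a positive threshold,
the dissipation wavenumber of the slice is finite at a.e. time (only finitely many levels are
saturated), by the slice bound `(c₀ν)² Λ ≤ (c₀ν)² + C ∫|∇u(t)|²` and `∫|∇u(t)|² < ∞` a.e.
[cite: CheskidovShvydkoy2011, §4 (remark before Lemma 4.1)] -/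
theorem IsLerayHopfOn.ae_dissipationWavenumber_lt_top (hLH : IsLerayHopfOn T ν 0 u₀ u) {c₀ : ℝ}
    (hc₀ : 0 < c₀) (hν : 0 < ν) (hT : 0 < T) :
    ∀ᵐ t ∂(volume.restrict (Ioo 0 T)), dissipationWavenumber c₀ ν (u t) < ∞ := by
  obtain ⟨C, hC⟩ := exists_dissipationWavenumber_mul_le
  obtain ⟨m, G, -, hae, -⟩ := hLH.exists_measurable_dissipation hν hT
  have ha0 : ENNReal.ofReal (c₀ * ν) ^ 2 ≠ 0 :=
    pow_ne_zero _ (by rw [Ne, ENNReal.ofReal_eq_zero, not_le]; exact mul_pos hc₀ hν)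
  filter_upwards [hae, ae_restrict_mem measurableSet_Ioo] with t ht htI
  obtain ⟨hGt, hmt, hfin⟩ := ht
  have hv : MemLp (u t) 2 volume := hLH.memLp t (Ioo_subset_Icc_self htI)
  have h := hC c₀ ν (u t) (G t) hv hGt (by rw [hmt]; exact hfin)
  rw [hmt] at h
  have hrhs : ENNReal.ofReal (c₀ * ν) ^ 2 + C * m t < ∞ :=
    ENNReal.add_lt_top.2 ⟨ENNReal.pow_lt_top ENNReal.ofReal_lt_top,
      ENNReal.mul_lt_top ENNReal.coe_lt_top hfin⟩
  by_contra htop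
  rw [not_lt, top_le_iff] at htop
  rw [htop, ENNReal.mul_top ha0] at h
  exact absurd (h.trans_lt hrhs) (lt_irrefl _)

/-- **Cheskidov–Shvydkoy 2014, Lemma 4.1** ("Let `u(t)` be a Leray–Hopf solution to (NSE) with
`ν > 0` on `[0,T]`. Then `Λ ∈ L¹(0,T)`"), quantitative tree form: there is an absolute `C` such that
for every threshold `c₀`, every `ν > 0`, `T > 0` and every Leray–Hopf weak solution `u` of the
unforced Navier–Stokes system on `ℝ³ × [0,T)` with datum `u₀`,
`(c₀ν)² ∫₀ᵀ Λ_{c₀,ν}(u(t)) dt ≤ (c₀ν)² T + C E(u₀)/ν`, `E(u₀) = ½‖u₀‖₂²` (lower Lebesgue integral in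
`t`; the printed proof: Bernstein and `∫₀ᵀ‖∇u‖₂² ≤ E(u₀)/ν`). [cite: CheskidovShvydkoy2011, Lemma 4.1] -/
theorem exists_mul_lintegral_dissipationWavenumber_le :
    ∃ C : ℝ≥0, ∀ (c₀ ν T : ℝ) (u₀ : EuclideanSpace ℝ (Fin 3) → EuclideanSpace ℝ (Fin 3))
      (u : ℝ → EuclideanSpace ℝ (Fin 3) → EuclideanSpace ℝ (Fin 3)), 0 < ν → 0 < T →
      IsLerayHopfOn T ν 0 u₀ u →
      ENNReal.ofReal (c₀ * ν) ^ 2 * ∫⁻ t in Ioo 0 T, dissipationWavenumber c₀ ν (u t) ≤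
        ENNReal.ofReal (c₀ * ν) ^ 2 * ENNReal.ofReal T +
          C * ENNReal.ofReal (VectorCalculus.kineticEnergy u₀ / ν) := by
  obtain ⟨C, hC⟩ := exists_dissipationWavenumber_mul_le
  refine ⟨C, fun c₀ ν T u₀ u hν hT hLH => ?_⟩
  obtain ⟨m, G, hmeas, hae, hm⟩ := hLH.exists_measurable_dissipation hν hT
  set a : ℝ≥0∞ := ENNReal.ofReal (c₀ * ν) with ha
  have hane : a ^ 2 ≠ ∞ := ENNReal.pow_ne_top ENNReal.ofReal_ne_top
  -- pointwise a.e. bound on the slices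
  have hpt : ∀ᵐ t ∂(volume.restrict (Ioo 0 T)),
      a ^ 2 * dissipationWavenumber c₀ ν (u t) ≤ a ^ 2 + C * m t := by
    filter_upwards [hae, ae_restrict_mem measurableSet_Ioo] with t ht htI
    obtain ⟨hGt, hmt, hfin⟩ := ht
    have hv : MemLp (u t) 2 volume := hLH.memLp t (Ioo_subset_Icc_self htI)
    have h := hC c₀ ν (u t) (G t) hv hGt (by rw [hmt]; exact hfin)
    rwa [hmt] at h
  calc a ^ 2 * ∫⁻ t in Ioo 0 T, dissipationWavenumber c₀ ν (u t)
      = ∫⁻ t in Ioo 0 T, a ^ 2 * dissipationWavenumber c₀ ν (u t) :=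
        (lintegral_const_mul' _ _ hane).symm
    _ ≤ ∫⁻ t in Ioo 0 T, (a ^ 2 + C * m t) := lintegral_mono_ae hpt
    _ = (∫⁻ _ in Ioo 0 T, a ^ 2) + ∫⁻ t in Ioo 0 T, C * m t :=
        lintegral_add_left measurable_const _
    _ = a ^ 2 * ENNReal.ofReal T + C * ∫⁻ t in Ioo 0 T, m t := by
        rw [setLIntegral_const, Real.volume_Ioo, sub_zero, lintegral_const_mul' _ _ ENNReal.coe_ne_top]
    _ ≤ a ^ 2 * ENNReal.ofReal T + C * ENNReal.ofReal (VectorCalculus.kineticEnergy u₀ / ν) := by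
        gcongr

/-- **Lemma 4.1, divided through** (for a positive threshold): `∫₀ᵀ Λ_{c₀,ν}(u(t)) dt ≤ T + C E(u₀)/(c₀²ν³)`
for every Leray–Hopf solution on `ℝ³ × [0,T)`, `ν > 0`, `c₀ > 0`. [cite: CheskidovShvydkoy2011, Lemma 4.1] -/
theorem exists_lintegral_dissipationWavenumber_le :
    ∃ C : ℝ≥0, ∀ (c₀ ν T : ℝ) (u₀ : EuclideanSpace ℝ (Fin 3) → EuclideanSpace ℝ (Fin 3))
      (u : ℝ → EuclideanSpace ℝ (Fin 3) → EuclideanSpace ℝ (Fin 3)), 0 < c₀ → 0 < ν → 0 < T →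
      IsLerayHopfOn T ν 0 u₀ u →
      ∫⁻ t in Ioo 0 T, dissipationWavenumber c₀ ν (u t) ≤
        ENNReal.ofReal T + ENNReal.ofReal (C * VectorCalculus.kineticEnergy u₀ / (c₀ ^ 2 * ν ^ 3)) := by
  obtain ⟨C, hC⟩ := exists_mul_lintegral_dissipationWavenumber_le
  refine ⟨C, fun c₀ ν T u₀ u hc₀ hν hT hLH => ?_⟩
  have h := hC c₀ ν T u₀ u hν hT hLH
  set a : ℝ≥0∞ := ENNReal.ofReal (c₀ * ν) with ha
  have hcν : 0 < c₀ * ν := mul_pos hc₀ hν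
  have ha0 : a ^ 2 ≠ 0 := pow_ne_zero _ (by rwa [ha, Ne, ENNReal.ofReal_eq_zero, not_le])
  have hane : a ^ 2 ≠ ∞ := ENNReal.pow_ne_top ENNReal.ofReal_ne_top
  have hc0 : c₀ ≠ 0 := hc₀.ne'
  have hν0 : ν ≠ 0 := hν.ne'
  -- `a² · (C E / (c₀² ν³)) = C · (E / ν)`
  have e1 : a ^ 2 = ENNReal.ofReal ((c₀ * ν) ^ 2) := by rw [ha, ENNReal.ofReal_pow hcν.le]
  have e2 : (C : ℝ≥0∞) = ENNReal.ofReal (C : ℝ) := ENNReal.ofReal_coe_nnreal.symm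
  have hkey : a ^ 2 * ENNReal.ofReal (C * VectorCalculus.kineticEnergy u₀ / (c₀ ^ 2 * ν ^ 3)) =
      C * ENNReal.ofReal (VectorCalculus.kineticEnergy u₀ / ν) := by
    rw [e1, e2, ← ENNReal.ofReal_mul (sq_nonneg _), ← ENNReal.ofReal_mul C.coe_nonneg]
    congr 1
    field_simp
  refine (ENNReal.mul_le_mul_iff_right ha0 hane).1 ?_
  rw [mul_add, hkey]
  exact h

/-- **Weak-`L¹` form on the level sets** (Chebyshev on Lemma 4.1's integrand; the shape used by route
`WeakLambdaEndpoint`, whose `{t | ∃ j > n saturated}` is `{Λ > 2^n}`): with an absolute `C`, for every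
Leray–Hopf solution on `ℝ³ × [0,T)` (`ν > 0`, `T > 0`) and every `n`,
`(c₀ν)² 2^{n+1} · |{t ∈ (0,T) | ∃ j > n, c₀ν2^j ≤ ‖Δ̇_j u(t)‖_∞}| ≤ C E(u₀)/ν`. The level set need not be
measurable (outer measure); Markov's inequality is applied to the time-measurable dissipation of
`IsLerayHopfOn.exists_measurable_dissipation`, which dominates it a.e. [cite: CheskidovShvydkoy2011, Lemma 4.1] -/
theorem exists_two_pow_mul_volume_setOf_saturated_le :
    ∃ C : ℝ≥0, ∀ (c₀ ν T : ℝ) (u₀ : EuclideanSpace ℝ (Fin 3) → EuclideanSpace ℝ (Fin 3))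
      (u : ℝ → EuclideanSpace ℝ (Fin 3) → EuclideanSpace ℝ (Fin 3)), 0 < ν → 0 < T →
      IsLerayHopfOn T ν 0 u₀ u → ∀ n : ℕ,
      ENNReal.ofReal (c₀ * ν) ^ 2 * 2 ^ (n + 1) *
          volume {t ∈ Ioo 0 T | ∃ j : ℕ, n < j ∧ IsSaturatedLevel c₀ ν (u t) j} ≤
        C * ENNReal.ofReal (VectorCalculus.kineticEnergy u₀ / ν) := by
  obtain ⟨C, hC⟩ := exists_two_pow_mul_le_dissipation_of_saturated
  refine ⟨C, fun c₀ ν T u₀ u hν hT hLH n => ?_⟩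
  obtain ⟨m, G, hmeas, hae, hm⟩ := hLH.exists_measurable_dissipation hν hT
  set a : ℝ≥0∞ := ENNReal.ofReal (c₀ * ν) with ha
  set μ : Measure ℝ := volume.restrict (Ioo 0 T) with hμ
  set Sn : Set ℝ := {t ∈ Ioo 0 T | ∃ j : ℕ, n < j ∧ IsSaturatedLevel c₀ ν (u t) j} with hSn
  set En : Set ℝ := {t | a ^ 2 * 2 ^ (n + 1) ≤ C * m t} with hEn
  -- the level set is a.e. contained in the Chebyshev set of the measurable dissipation
  have hsub : ∀ᵐ t ∂μ, t ∈ Sn → t ∈ En := by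
    filter_upwards [hae] with t ht hS
    obtain ⟨hGt, hmt, hfin⟩ := ht
    obtain ⟨htI, j, hnj, hj⟩ := hS
    have hv : MemLp (u t) 2 volume := hLH.memLp t (Ioo_subset_Icc_self htI)
    have h := hC c₀ ν j (u t) (G t) hv hGt (by rw [hmt]; exact hfin) hj
    rw [hmt] at h
    calc a ^ 2 * 2 ^ (n + 1) ≤ a ^ 2 * 2 ^ j := by
          gcongr
          · exact one_le_two
          · exact Nat.succ_le_of_lt hnj
      _ ≤ C * m t := h
  have hvol : volume Sn = μ Sn := by
    rw [hμ, Measure.restrict_apply' measurableSet_Ioo]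
    congr 1
    ext t
    simp only [hSn, mem_inter_iff, mem_setOf_eq]
    tauto
  have hmono : μ Sn ≤ μ En := measure_mono_ae hsub
  have hmarkov : a ^ 2 * 2 ^ (n + 1) * μ En ≤ ∫⁻ t, C * m t ∂μ :=
    mul_meas_ge_le_lintegral₀ ((hmeas.const_mul _).aemeasurable) _
  calc a ^ 2 * 2 ^ (n + 1) * volume Sn = a ^ 2 * 2 ^ (n + 1) * μ Sn := by rw [hvol]
    _ ≤ a ^ 2 * 2 ^ (n + 1) * μ En := by gcongr
    _ ≤ ∫⁻ t, C * m t ∂μ := hmarkov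
    _ = C * ∫⁻ t in Ioo 0 T, m t := lintegral_const_mul' _ _ ENNReal.coe_ne_top
    _ ≤ C * ENNReal.ofReal (VectorCalculus.kineticEnergy u₀ / ν) := by gcongr

/-- **`Λ ∈ L^{1,∞}(0,T)` in the spelling of route `WeakLambdaEndpoint`** (its registered first rung
`stub_weakL1` of the residual `WeakLambdaApriori`): for every `c₀ > 0`, `ν > 0`, `T > 0` and every
Leray–Hopf solution `u` on `ℝ³ × [0,T)` from `u₀` there is `A` with
`2^n · |{t ∈ (0,T) | ∃ j > n, ofReal(c₀ν) 2^j ≤ ‖blockFn j (u t)‖_{L^∞}}| ≤ A` for all `n`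
(`A = C E(u₀) / (2 c₀² ν³)`). [cite: CheskidovShvydkoy2011, Lemma 4.1] -/
theorem IsLerayHopfOn.exists_two_pow_mul_volume_le (hLH : IsLerayHopfOn T ν 0 u₀ u)
    {c₀ : ℝ} (hc₀ : 0 < c₀) (hν : 0 < ν) (hT : 0 < T) :
    ∃ A : ℝ≥0, ∀ n : ℕ, (2 : ℝ≥0∞) ^ n *
        volume {t ∈ Ioo 0 T | ∃ j : ℕ, n < j ∧
          ENNReal.ofReal (c₀ * ν) * 2 ^ j ≤ eLpNorm (blockFn (j : ℤ) (u t)) ⊤ volume} ≤ A := by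
  obtain ⟨C, hC⟩ := exists_two_pow_mul_volume_setOf_saturated_le
  set a : ℝ≥0∞ := ENNReal.ofReal (c₀ * ν) with ha
  set B : ℝ≥0∞ := C * ENNReal.ofReal (VectorCalculus.kineticEnergy u₀ / ν) with hB
  have hcν : 0 < c₀ * ν := mul_pos hc₀ hν
  have ha0 : a ^ 2 * 2 ≠ 0 :=
    mul_ne_zero (pow_ne_zero _ (by rwa [ha, Ne, ENNReal.ofReal_eq_zero, not_le])) two_ne_zero
  have hane : a ^ 2 * 2 ≠ ∞ :=
    ENNReal.mul_ne_top (ENNReal.pow_ne_top ENNReal.ofReal_ne_top) ENNReal.ofNat_ne_top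
  have hBne : B ≠ ∞ := ENNReal.mul_ne_top ENNReal.coe_ne_top ENNReal.ofReal_ne_top
  refine ⟨(B / (a ^ 2 * 2)).toNNReal, fun n => ?_⟩
  rw [ENNReal.coe_toNNReal (ENNReal.div_lt_top hBne ha0).ne]
  have h := hC c₀ ν T u₀ u hν hT hLH n
  rw [ENNReal.le_div_iff_mul_le (Or.inl ha0) (Or.inl hane)]
  calc (2 : ℝ≥0∞) ^ n * volume {t ∈ Ioo 0 T | ∃ j : ℕ, n < j ∧
          ENNReal.ofReal (c₀ * ν) * 2 ^ j ≤ eLpNorm (blockFn (j : ℤ) (u t)) ⊤ volume} * (a ^ 2 * 2)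
      = a ^ 2 * 2 ^ (n + 1) *
          volume {t ∈ Ioo 0 T | ∃ j : ℕ, n < j ∧ IsSaturatedLevel c₀ ν (u t) j} := by
        rw [pow_succ]; simp only [IsSaturatedLevel]; ring
    _ ≤ B := h

/-- **`Λ ∈ L^∞(0,T)` is Cheskidov–Shvydkoy 2010's criterion** ("In terms of `Λ(t)` this regularity
condition can be restated as `Λ ∈ L^∞(0,T)`", Cheskidov–Shvydkoy 2014, §4, of the criterion
`limsup_q sup_t λ_q⁻¹‖u_q(t)‖_∞ < c₀ν` = tree `cheskidov_shvydkoy_dyadic`, discharged as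
`cheskidov_shvydkoy_dyadic_holds`): fed that named statement, there is `c > 0` such that every
Leray–Hopf solution on `ℝ³ × [0,T)` (`ν > 0`) whose dissipation wavenumber at threshold `c` stays below
a fixed dyadic level, `Λ_{c,ν}(u(t)) ≤ 2^N` for all `t ∈ (0,T)`, is regular on `(0,T]` in the house
rendering (a.e. equal to a classical solution on `(0,T]`). The dictionary step is
`IsDistributionOf.lpBlockWeight_top_eq` (function-level block sup norms = the distribution-level
weights of the named statement); `c` is half the constant of `cheskidov_shvydkoy_dyadic`. [cite: CheskidovShvydkoy2011, §4 (Λ ∈ L^∞ restatement of CS 2010 Lemma 3.2)] -/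
theorem regular_of_dissipationWavenumber_le (hCS : cheskidov_shvydkoy_dyadic) :
    ∃ c : ℝ, 0 < c ∧ ∀ (ν T : ℝ), 0 < ν → 0 < T →
      ∀ (u₀ : EuclideanSpace ℝ (Fin 3) → EuclideanSpace ℝ (Fin 3))
        (u : ℝ → EuclideanSpace ℝ (Fin 3) → EuclideanSpace ℝ (Fin 3))
        (U : ℝ → 𝓢'(EuclideanSpace ℝ (Fin 3), EuclideanSpace ℂ (Fin 3))),
      IsLerayHopfOn T ν 0 u₀ u → (∀ t ∈ Icc 0 T, IsDistributionOf (u t) (U t)) →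
      (∃ N : ℕ, ∀ t ∈ Ioo 0 T, dissipationWavenumber c ν (u t) ≤ 2 ^ N) →
      ∃ (v : ℝ → EuclideanSpace ℝ (Fin 3) → EuclideanSpace ℝ (Fin 3))
        (p' : ℝ → EuclideanSpace ℝ (Fin 3) → ℝ),
        IsClassicalNSSolutionOn (Ioc 0 T) ν 0 v p' ∧ ∀ t ∈ Ioc 0 T, u t =ᵐ[volume] v t := by
  obtain ⟨c, hc, H⟩ := hCS
  refine ⟨c / 2, by linarith, fun ν T hν hT u₀ u U hLH hU hN => H ν T hν hT u₀ u U hLH hU ?_⟩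
  obtain ⟨N, hN⟩ := hN
  -- above level `N` no level is saturated at threshold `c/2`, at any time
  have hbound : ∀ j : ℕ, N < j →
      ⨆ t ∈ Ioo 0 T, FunctionSpaces.lpBlockWeight (-1) ∞ (U t) (j : ℤ) ≤ ENNReal.ofReal (c / 2 * ν) := by
    intro j hj
    refine iSup₂_le fun t ht => ?_
    have hv : MemLp (u t) 2 volume := hLH.memLp t (Ioo_subset_Icc_self ht)
    rw [(hU t (Ioo_subset_Icc_self ht)).lpBlockWeight_top_eq hv (-1) (j : ℤ)]
    have hns : ¬ IsSaturatedLevel (c / 2) ν (u t) j := by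
      intro hsat
      have h1 : (2 : ℝ≥0∞) ^ j ≤ 2 ^ N := (two_pow_le_dissipationWavenumber hsat).trans (hN t ht)
      have h2 : ((2 ^ N : ℕ) : ℝ≥0∞) < ((2 ^ j : ℕ) : ℝ≥0∞) := by
        exact_mod_cast Nat.pow_lt_pow_right (by norm_num) hj
      push_cast at h2
      exact absurd h1 (not_le.2 h2)
    rw [isSaturatedLevel_iff, not_le] at hns
    have hexp : ((j : ℤ) : ℝ) * (-1 : ℝ) + (j : ℕ) = 0 := by push_cast; ring
    have hpow : (2 : ℝ≥0∞) ^ (((j : ℤ) : ℝ) * (-1 : ℝ)) * (2 : ℝ≥0∞) ^ j = 1 := by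
      rw [← ENNReal.rpow_natCast, ← ENNReal.rpow_add _ _ (by norm_num) (by norm_num), hexp,
        ENNReal.rpow_zero]
    calc (2 : ℝ≥0∞) ^ (((j : ℤ) : ℝ) * (-1 : ℝ)) * eLpNorm (blockFn (j : ℤ) (u t)) ∞ volume
        ≤ (2 : ℝ≥0∞) ^ (((j : ℤ) : ℝ) * (-1 : ℝ)) * (ENNReal.ofReal (c / 2 * ν) * 2 ^ j) := by
          gcongr
      _ = ENNReal.ofReal (c / 2 * ν) := by
          rw [mul_comm (ENNReal.ofReal _), ← mul_assoc, hpow, one_mul]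
  have hlt : ENNReal.ofReal (c / 2 * ν) < ENNReal.ofReal (c * ν) := by
    rw [ENNReal.ofReal_lt_ofReal_iff (mul_pos hc hν)]
    nlinarith
  refine lt_of_le_of_lt (limsup_le_of_le (by isBoundedDefault) ?_) hlt
  filter_upwards [eventually_gt_atTop N] with j hj
  exact hbound j hj

end LerayHopf

end Literature.Analysis.FluidPDE

end
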